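import Mathlib
import Summits.ValiantsHypothesis.ValiantsHypothesis.Theses.ProjectionRigidity
import Literature.LinearAlgebra.Matrix.PermanentLaplace

/-!
# Birth skeleton (BC3) for crux `ProjectionRigidity.ProjLaplaceDoubling`
# (stmt-ValiantsHypothesis-16002, route-ValiantsHypothesis-ProjectionRigidity; skeleton-register, gen 1)

Crux decl `Summit.ValiantsHypothesis.ValiantsHypothesis.Theses.ProjectionRigidity.ProjLaplaceDoubling`
(rank 3 of the route), verbatim:
`ProjOptimalUnique → ∀ n ≥ 3, 2 ^ n - 1 ≤ pdc(per_n) → 2 ^ (n + 1) - 1 ≤ pdc(per_{n+1})`,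
`pdc = detProjectionComplexity` (Valiant's projection model: every cell a variable or a constant).

## The line: LAPLACE RESTRICTION ∘ WINDOW REDUCTION ∘ CORE PACKING (the route's own two-layer plan, typed)

Write `N = pdc(per_n)` and let `A` be an optimal projection of `per_{n+1}`, of size `m = pdc(per_{n+1})`
(the infimum is attained: `isDetProjection_detProjectionComplexity`, tree).  For every cell `(i, j)` of the
generic `(n+1) × (n+1)` matrix the LAPLACE RESTRICTION `ρ_{ij}` — row `i := e_j`, rest of column `j := 0`,
remaining minor relabelled along `i.succAbove × j.succAbove` (`restrictSubst`, this file) — is a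
`{0, 1, variables}`-valued substitution, so `A.map ρ_{ij}` is again a PROJECTION matrix, of the same size `m`,
and it computes `ρ_{ij}(per_{n+1}) = per_n` (Laplace expansion of the permanent along row `i`,
`Matrix.permanent_eq_sum_row`, tree).  This restriction calculus is PROVED here (it is the glue, not a stub).
If `m ≤ 2^(n+1) - 2` then, by the crux's own hypothesis `2^n - 1 ≤ N`, every restriction lies in the
DOUBLING WINDOW `m ≤ 2·N`, and the two registered stubs take over:

* `stub_windowReduction` (= the route's foreseen child **ProjWindowReduction**, projection form of the parent
  route's never-refuted `GrenetRigidity.WindowStability`): for `n ≥ 3` with `2^n - 1 ≤ N`, every projection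
  matrix `B` of size `m ≤ 2·N` with `det B = per_n` is a WINDOW over an optimal projection core:
  there are constant `P, Q ∈ GL_m(ℂ)` and `a` with `P·B·Q` block upper triangular for the partition
  `(a | N | m - a - N)` whose middle `N × N` diagonal block is itself a PROJECTION matrix with determinant
  exactly `per_n` (an optimal projection of `per_n`).  This is the normal form produced by Hüttenhain–Ikenmeyer
  style reductions (constant row/column operations + Laplace along unit rows = junk AFTER the core, along unit
  columns = junk BEFORE the core; arXiv:1410.8202 §4), and it is what the `(n+1)²` restrictions of Grenet's
  `(2^(n+1) - 1)`-projection visibly satisfy (core = a relabelled Grenet_n, junk = the subsets through the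
  deleted column, unitriangular).  The three-block shape is forced: a live core with an unreachable junk vertex
  feeding into it (`[[1, x·e_Kᵀ], [0, Grenet_n]]`) is NOT constant-gauge equivalent to a core-first two-block
  form (registrar's NOTES.md), so neither two-block variant would be true.
* `stub_corePacking` (= the route's foreseen child **ProjCorePacking**, with the crux's uniqueness antecedent
  instantiated at level `n` as ITS tool): for `n ≥ 3`, uniqueness of optimal projections of `per_n` (the
  `n`-instance of `ProjOptimalUnique`, verbatim) and `2^n - 1 ≤ N` imply that a projection matrix `A` with
  `det A = per_{n+1}` all of whose `(n+1)²` Laplace restrictions are windows has size `≥ 2^(n+1) - 1`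
  (the cores are relabelled Grenet_n's by uniqueness; their vertices are identified by the sub-permanents they
  compute; the `n+1` cores of one row cover all proper subsets of `[n+1]`: `2·(2^n - 1) + 1` rows).

COMPOSITION `ProjLaplaceDoubling_of : Stmt.stub_windowReduction → Stmt.stub_corePacking → ProjLaplaceDoubling`
(kernel-checked, no sorry): attained infimum ↦ matrix `A` (`AlgHom.map_det` + `mvPolynomialX`), restriction
calculus (`map_restrict_isProj`, `det_map_restrict`, `aeval_restrictSubst_perPoly`), the window arithmetic
`m ≤ 2^(n+1) - 2 ≤ 2·N` from the crux's hypothesis, then the two stubs.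

Neither stub is comparable to the crux or to the summit by a cheap implication: `stub_windowReduction` speaks of
ONE level `n` and of non-optimal projections (no `n+1` anywhere); `stub_corePacking` needs the window normal
form of all restrictions as a HYPOTHESIS, which nothing in the crux provides; BC3 probes
(`stub → ProjLaplaceDoubling`, `stub → ValiantsHypothesis` by `first | exact? | simpa | aesop`) fail for both —
registrar's NOTES.md / `Lines/birth.md`.

## Shape (skeleton audit by-name rule, as in `Cruxes/ContractiveHardness/Lines/birth.lean`)
* `Stmt.stub_…` — the two stub statements as `Prop`s (readable: via the local vocabulary `restrictSubst`,
  `IsWindow`), named like the stubs;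
* `stub_…` — the SAME statements with the vocabulary INLINED (def-free beyond Mathlib + `Literature` +
  the route file), as sorried theorems: the REGISTERED stubs; `sorry` occurs nowhere else; being def-free they
  can land as `Theorems/ProjectionRigidityProjLaplaceDoubling<Stub>.lean` with `--supports stmt-ValiantsHypothesis-16002`;
* `ProjLaplaceDoubling_of` — the composition, real proof; `ProjLaplaceDoubling_proof : ProjLaplaceDoubling :=
  ProjLaplaceDoubling_of stub_windowReduction stub_corePacking` ties the two copies (definitional unfolding).

**Disproof used.** None exists: `Cruxes/ProjLaplaceDoubling/` had no workfiles (no `Disproof.lean`, no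
`Negative/` lemma) at registration (2026-08-17).  Negatives index (4 entries): the affine `OptimalUnique` /
`OptimalUniqueThree` (stmt-3735/3738) and `UlrichPadded.NoTightInfinity` (stmt-5668) are killed by POLYNOMIAL
(Koszul) gauge twists whose matrices carry `-X` entries — not Valiant projections; both stubs quantify over
genuine projection matrices (`X v` or `C c` in every cell) and use constant gauge only.
Hardest stub: `stub_corePacking`.
-/

namespace Summit.ValiantsHypothesis.ValiantsHypothesis.Cruxes.ProjLaplaceDoubling.Birth

open MvPolynomial Matrix
open Literature.Computability.AlgebraicComplexity
open Summit.ValiantsHypothesis.ValiantsHypothesis.Theses.ProjectionRigidity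

set_option linter.dupNamespace false

noncomputable section

/-! ## Vocabulary: Laplace restrictions and windows -/

/-- The Laplace restriction substitution `ρ_{ij}`: row `i` of the generic `(n+1) × (n+1)` matrix
becomes the unit vector `e_j`, the rest of column `j` becomes `0`, and the remaining minor is
relabelled to the generic `n × n` matrix along `i.succAbove × j.succAbove`. -/
def restrictSubst (n : ℕ) (i j : Fin (n + 1)) :
    Fin (n + 1) × Fin (n + 1) → MvPolynomial (Fin n × Fin n) ℂ :=
  fun p => Fin.insertNth (α := fun _ => MvPolynomial (Fin n × Fin n) ℂ) i
    (if p.2 = j then 1 else 0)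
    (fun i' => Fin.insertNth (α := fun _ => MvPolynomial (Fin n × Fin n) ℂ) j 0
      (fun j' => X (i', j')) p.2) p.1

/-- `IsWindow n m B`: the `m × m` matrix `B` over `ℂ[x_{n×n}]` is a WINDOW over an optimal projection core —
constant gauge `P, Q ∈ GL_m(ℂ)` makes `B' = P·B·Q` block upper triangular for the partition
`(a | N | m - a - N)`, `N = pdc(per_n)`, with middle `N × N` block a projection matrix (every entry a
variable or a constant) of determinant exactly `per_n`. -/
def IsWindow (n m : ℕ) (B : Matrix (Fin m) (Fin m) (MvPolynomial (Fin n × Fin n) ℂ)) : Prop :=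
  ∃ (a : ℕ) (h : a + detProjectionComplexity (perPoly (Fin n) ℂ) ≤ m) (P Q : GL (Fin m) ℂ)
    (B' : Matrix (Fin m) (Fin m) (MvPolynomial (Fin n × Fin n) ℂ)),
    B' = (P : Matrix (Fin m) (Fin m) ℂ).map MvPolynomial.C * B * (Q : Matrix (Fin m) (Fin m) ℂ).map MvPolynomial.C ∧
    (∀ p q : Fin m, a ≤ (p : ℕ) → (q : ℕ) < a → B' p q = 0) ∧
    (∀ p q : Fin m, a + detProjectionComplexity (perPoly (Fin n) ℂ) ≤ (p : ℕ) →
      (q : ℕ) < a + detProjectionComplexity (perPoly (Fin n) ℂ) → B' p q = 0) ∧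
    (∀ p q : Fin (detProjectionComplexity (perPoly (Fin n) ℂ)),
      (∃ v, B' (Fin.castLE h (Fin.natAdd a p)) (Fin.castLE h (Fin.natAdd a q)) = MvPolynomial.X v) ∨
        ∃ c, B' (Fin.castLE h (Fin.natAdd a p)) (Fin.castLE h (Fin.natAdd a q)) = MvPolynomial.C c) ∧
    (B'.submatrix (fun p : Fin (detProjectionComplexity (perPoly (Fin n) ℂ)) => Fin.castLE h (Fin.natAdd a p))
        (fun q : Fin (detProjectionComplexity (perPoly (Fin n) ℂ)) => Fin.castLE h (Fin.natAdd a q))).det =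
      perPoly (Fin n) ℂ

/-! ## Restriction calculus (proved; used by the composition) -/

theorem restrictSubst_apply_row (n : ℕ) (i j c : Fin (n + 1)) :
    restrictSubst n i j (i, c) = if c = j then 1 else 0 := by
  simp [restrictSubst]

theorem restrictSubst_apply_col (n : ℕ) (i j : Fin (n + 1)) (i' : Fin n) :
    restrictSubst n i j (i.succAbove i', j) = 0 := by
  simp [restrictSubst]

theorem restrictSubst_apply_succAbove (n : ℕ) (i j : Fin (n + 1)) (i' j' : Fin n) :
    restrictSubst n i j (i.succAbove i', j.succAbove j') = X (i', j') := by
  simp [restrictSubst]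

/-- Every value of `ρ_{ij}` is a variable or a constant (`0` or `1`). [folklore] -/
theorem restrictSubst_isProj (n : ℕ) (i j : Fin (n + 1)) (v : Fin (n + 1) × Fin (n + 1)) :
    (∃ w, restrictSubst n i j v = X w) ∨ ∃ c, restrictSubst n i j v = C c := by
  obtain ⟨r, c⟩ := v
  rcases eq_or_ne r i with rfl | hr
  · by_cases hc : c = j
    · exact Or.inr ⟨1, by simp [restrictSubst_apply_row, hc]⟩
    · exact Or.inr ⟨0, by simp [restrictSubst_apply_row, hc]⟩
  · obtain ⟨i', rfl⟩ := Fin.exists_succAbove_eq hr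
    rcases eq_or_ne c j with rfl | hc
    · exact Or.inr ⟨0, by simp [restrictSubst_apply_col]⟩
    · obtain ⟨j', rfl⟩ := Fin.exists_succAbove_eq hc
      exact Or.inl ⟨(i', j'), restrictSubst_apply_succAbove n i j i' j'⟩

/-- **Laplace restriction of the generic permanent**: `ρ_{ij}(per_{n+1}) = per_n` — expand along row `i`
(`Matrix.permanent_eq_sum_row`); only column `j` survives and the surviving minor is the generic `n × n`
matrix. [folklore] -/
theorem aeval_restrictSubst_perPoly (n : ℕ) (i j : Fin (n + 1)) :
    aeval (restrictSubst n i j) (perPoly (Fin (n + 1)) ℂ) = perPoly (Fin n) ℂ := by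
  have h : aeval (restrictSubst n i j) (perPoly (Fin (n + 1)) ℂ) =
      (Matrix.of fun a b => restrictSubst n i j (a, b)).permanent := by
    simp [perPoly, Matrix.permanent, map_sum, map_prod]
  rw [h, Matrix.permanent_eq_sum_row _ i, Finset.sum_eq_single j]
  · have hsub : (Matrix.of fun a b => restrictSubst n i j (a, b)).submatrix i.succAbove j.succAbove =
        mvPolynomialX (Fin n) (Fin n) ℂ := by
      ext a b
      simp [Matrix.mvPolynomialX_apply, restrictSubst_apply_succAbove]
    rw [hsub, Matrix.of_apply, restrictSubst_apply_row, if_pos rfl, one_mul]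
    rfl
  · intro c _ hc
    rw [Matrix.of_apply, restrictSubst_apply_row, if_neg hc, zero_mul]
  · intro h
    exact absurd (Finset.mem_univ j) h

/-- Restriction keeps projection matrices projection matrices. [folklore] -/
theorem map_restrict_isProj {n m : ℕ} (i j : Fin (n + 1))
    {A : Matrix (Fin m) (Fin m) (MvPolynomial (Fin (n + 1) × Fin (n + 1)) ℂ)}
    (hA : ∀ p q, (∃ v, A p q = X v) ∨ ∃ c, A p q = C c) (p q : Fin m) :
    (∃ v, (A.map (aeval (restrictSubst n i j))) p q = X v) ∨
      ∃ c, (A.map (aeval (restrictSubst n i j))) p q = C c := by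
  rw [Matrix.map_apply]
  rcases hA p q with ⟨v, hv⟩ | ⟨c, hc⟩
  · rw [hv, aeval_X]
    exact restrictSubst_isProj n i j v
  · rw [hc, algHom_C, algebraMap_eq]
    exact Or.inr ⟨c, rfl⟩

/-- The restriction of a matrix computing `per_{n+1}` computes `per_n`. [folklore] -/
theorem det_map_restrict {n m : ℕ} (i j : Fin (n + 1))
    {A : Matrix (Fin m) (Fin m) (MvPolynomial (Fin (n + 1) × Fin (n + 1)) ℂ)}
    (hA : A.det = perPoly (Fin (n + 1)) ℂ) :
    (A.map (aeval (restrictSubst n i j))).det = perPoly (Fin n) ℂ := by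
  rw [← AlgHom.mapMatrix_apply, ← AlgHom.map_det, hA, aeval_restrictSubst_perPoly]

/-- The attained infimum as a matrix: an optimal PROJECTION matrix of `per_k`, of size `pdc(per_k)`.
(`isDetProjection_detProjectionComplexity`, Valiant 1979 Thm. 1 in projection form, tree.) [folklore] -/
theorem exists_optimal_projMatrix (k : ℕ) :
    ∃ A : Matrix (Fin (detProjectionComplexity (perPoly (Fin k) ℂ)))
        (Fin (detProjectionComplexity (perPoly (Fin k) ℂ))) (MvPolynomial (Fin k × Fin k) ℂ),
      (∀ p q, (∃ v, A p q = X v) ∨ ∃ c, A p q = C c) ∧ A.det = perPoly (Fin k) ℂ := by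
  obtain ⟨a, ha, hdet⟩ := isDetProjection_detProjectionComplexity (perPoly (Fin k) ℂ)
  refine ⟨Matrix.of fun p q => a (p, q), fun p q => ha (p, q), ?_⟩
  have hmap : (aeval a).mapMatrix (mvPolynomialX (Fin (detProjectionComplexity (perPoly (Fin k) ℂ)))
      (Fin (detProjectionComplexity (perPoly (Fin k) ℂ))) ℂ) = Matrix.of fun p q => a (p, q) := by
    ext p q
    simp [Matrix.mvPolynomialX_apply]
  rw [detPoly, AlgHom.map_det, hmap] at hdet
  exact hdet.symm

/-! ## The two stub statements (readable form, via the vocabulary above) -/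

/-- STUB 1 — WINDOW REDUCTION (`ProjWindowReduction`; open).  For `n ≥ 3` with `2^n - 1 ≤ N = pdc(per_n)`,
every `m × m` projection matrix `B` (`m ≤ 2·N`) with `det B = per_n` is a window over an optimal projection
core (`IsWindow`).  Why plausibly true: it is the normal form of the HI16 reductions, exact on every
restriction of Grenet's projection, and the affine twin (`GrenetRigidity.WindowStability`, doubling window)
was mooted, never refuted.  Why it might fail: ONE irreducible non-optimal projection of `per_n` in the window
`(N, 2N]` (a cancellative pattern, a Glynn-type design compressed below `2N`) refutes it at that `n`.
Size: XL (open). -/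
def Stmt.stub_windowReduction : Prop :=
  ∀ n : ℕ, 3 ≤ n → 2 ^ n - 1 ≤ detProjectionComplexity (perPoly (Fin n) ℂ) →
    ∀ m : ℕ, m ≤ 2 * detProjectionComplexity (perPoly (Fin n) ℂ) →
      ∀ B : Matrix (Fin m) (Fin m) (MvPolynomial (Fin n × Fin n) ℂ),
        (∀ p q, (∃ v, B p q = MvPolynomial.X v) ∨ ∃ c, B p q = MvPolynomial.C c) →
        B.det = perPoly (Fin n) ℂ → IsWindow n m B

/-- STUB 2 — CORE PACKING (`ProjCorePacking`; open, hardest).  For `n ≥ 3`: uniqueness of optimal projections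
of `per_n` modulo constant gauge × `G_per` × transpose (the level-`n` instance of the route's
`ProjOptimalUnique`, verbatim) and `2^n - 1 ≤ pdc(per_n)` imply that an `m × m` projection matrix `A` with
`det A = per_{n+1}` all of whose `(n+1)²` Laplace restrictions `A.map ρ_{ij}` are windows has
`2^(n+1) - 1 ≤ m`.  Why plausibly true: each core is a relabelled Grenet_n (uniqueness), its vertices are
pinned by the sub-permanents they compute, and the `n+1` cores of one row cover all proper subsets of `[n+1]`.
Why it might fail: the cores overlap (`2^(n-1) - 1` pairwise in Grenet_{n+1}) and come with `j`-dependent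
gauges — the cross-restriction identification of vertices is a gluing problem without precedent.
Size: XL (open). -/
def Stmt.stub_corePacking : Prop :=
  ∀ n : ℕ, 3 ≤ n →
    (∀ A B : Matrix (Fin (detProjectionComplexity (perPoly (Fin n) ℂ)))
        (Fin (detProjectionComplexity (perPoly (Fin n) ℂ))) (MvPolynomial (Fin n × Fin n) ℂ),
      (∀ i j, (∃ v, A i j = MvPolynomial.X v) ∨ ∃ c, A i j = MvPolynomial.C c) →
      (∀ i j, (∃ v, B i j = MvPolynomial.X v) ∨ ∃ c, B i j = MvPolynomial.C c) →
      A.det = perPoly (Fin n) ℂ → B.det = perPoly (Fin n) ℂ →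
      ∃ (P Q : GL (Fin (detProjectionComplexity (perPoly (Fin n) ℂ))) ℂ) (γ : GL (Fin n × Fin n) ℂ),
        γ ∈ permSymmetrySubst ℂ n ∧
        (B = (P : Matrix _ _ ℂ).map MvPolynomial.C *
              Literature.Computability.AlgebraicComplexity.Matrix.linSubstEntries γ A *
              (Q : Matrix _ _ ℂ).map MvPolynomial.C ∨
         B = (P : Matrix _ _ ℂ).map MvPolynomial.C *
              (Literature.Computability.AlgebraicComplexity.Matrix.linSubstEntries γ A).transpose *
              (Q : Matrix _ _ ℂ).map MvPolynomial.C)) →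
    2 ^ n - 1 ≤ detProjectionComplexity (perPoly (Fin n) ℂ) →
    ∀ (m : ℕ) (A : Matrix (Fin m) (Fin m) (MvPolynomial (Fin (n + 1) × Fin (n + 1)) ℂ)),
      (∀ p q, (∃ v, A p q = MvPolynomial.X v) ∨ ∃ c, A p q = MvPolynomial.C c) →
      A.det = perPoly (Fin (n + 1)) ℂ →
      (∀ i j : Fin (n + 1), IsWindow n m (A.map (MvPolynomial.aeval (restrictSubst n i j)))) →
      2 ^ (n + 1) - 1 ≤ m

/-! ## Registered stubs (the ONLY sorries of this file; vocabulary inlined, def-free) -/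

/-- Registered stub 1 = `Stmt.stub_windowReduction` with `IsWindow` inlined. -/
theorem stub_windowReduction :
    ∀ n : ℕ, 3 ≤ n → 2 ^ n - 1 ≤ detProjectionComplexity (perPoly (Fin n) ℂ) →
    ∀ m : ℕ, m ≤ 2 * detProjectionComplexity (perPoly (Fin n) ℂ) →
      ∀ B : Matrix (Fin m) (Fin m) (MvPolynomial (Fin n × Fin n) ℂ),
        (∀ p q, (∃ v, B p q = MvPolynomial.X v) ∨ ∃ c, B p q = MvPolynomial.C c) →
        B.det = perPoly (Fin n) ℂ →
        ∃ (a : ℕ) (h : a + detProjectionComplexity (perPoly (Fin n) ℂ) ≤ m) (P Q : GL (Fin m) ℂ)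
          (B' : Matrix (Fin m) (Fin m) (MvPolynomial (Fin n × Fin n) ℂ)),
          B' = (P : Matrix (Fin m) (Fin m) ℂ).map MvPolynomial.C * B *
                (Q : Matrix (Fin m) (Fin m) ℂ).map MvPolynomial.C ∧
          (∀ p q : Fin m, a ≤ (p : ℕ) → (q : ℕ) < a → B' p q = 0) ∧
          (∀ p q : Fin m, a + detProjectionComplexity (perPoly (Fin n) ℂ) ≤ (p : ℕ) →
            (q : ℕ) < a + detProjectionComplexity (perPoly (Fin n) ℂ) → B' p q = 0) ∧
          (∀ p q : Fin (detProjectionComplexity (perPoly (Fin n) ℂ)),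
            (∃ v, B' (Fin.castLE h (Fin.natAdd a p)) (Fin.castLE h (Fin.natAdd a q)) = MvPolynomial.X v) ∨
              ∃ c, B' (Fin.castLE h (Fin.natAdd a p)) (Fin.castLE h (Fin.natAdd a q)) = MvPolynomial.C c) ∧
          (B'.submatrix
              (fun p : Fin (detProjectionComplexity (perPoly (Fin n) ℂ)) => Fin.castLE h (Fin.natAdd a p))
              (fun q : Fin (detProjectionComplexity (perPoly (Fin n) ℂ)) => Fin.castLE h (Fin.natAdd a q))).det =
            perPoly (Fin n) ℂ := by
  sorry

/-- Registered stub 2 = `Stmt.stub_corePacking` with `restrictSubst` and `IsWindow` inlined. -/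
theorem stub_corePacking :
    ∀ n : ℕ, 3 ≤ n →
    (∀ A B : Matrix (Fin (detProjectionComplexity (perPoly (Fin n) ℂ)))
        (Fin (detProjectionComplexity (perPoly (Fin n) ℂ))) (MvPolynomial (Fin n × Fin n) ℂ),
      (∀ i j, (∃ v, A i j = MvPolynomial.X v) ∨ ∃ c, A i j = MvPolynomial.C c) →
      (∀ i j, (∃ v, B i j = MvPolynomial.X v) ∨ ∃ c, B i j = MvPolynomial.C c) →
      A.det = perPoly (Fin n) ℂ → B.det = perPoly (Fin n) ℂ →
      ∃ (P Q : GL (Fin (detProjectionComplexity (perPoly (Fin n) ℂ))) ℂ) (γ : GL (Fin n × Fin n) ℂ),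
        γ ∈ permSymmetrySubst ℂ n ∧
        (B = (P : Matrix _ _ ℂ).map MvPolynomial.C *
              Literature.Computability.AlgebraicComplexity.Matrix.linSubstEntries γ A *
              (Q : Matrix _ _ ℂ).map MvPolynomial.C ∨
         B = (P : Matrix _ _ ℂ).map MvPolynomial.C *
              (Literature.Computability.AlgebraicComplexity.Matrix.linSubstEntries γ A).transpose *
              (Q : Matrix _ _ ℂ).map MvPolynomial.C)) →
    2 ^ n - 1 ≤ detProjectionComplexity (perPoly (Fin n) ℂ) →
    ∀ (m : ℕ) (A : Matrix (Fin m) (Fin m) (MvPolynomial (Fin (n + 1) × Fin (n + 1)) ℂ)),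
      (∀ p q, (∃ v, A p q = MvPolynomial.X v) ∨ ∃ c, A p q = MvPolynomial.C c) →
      A.det = perPoly (Fin (n + 1)) ℂ →
      (∀ i j : Fin (n + 1),
        ∃ (a : ℕ) (h : a + detProjectionComplexity (perPoly (Fin n) ℂ) ≤ m) (P Q : GL (Fin m) ℂ)
          (B' : Matrix (Fin m) (Fin m) (MvPolynomial (Fin n × Fin n) ℂ)),
          B' = (P : Matrix (Fin m) (Fin m) ℂ).map MvPolynomial.C *
                A.map (MvPolynomial.aeval (fun p : Fin (n + 1) × Fin (n + 1) =>
                  Fin.insertNth (α := fun _ => MvPolynomial (Fin n × Fin n) ℂ) i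
                    (if p.2 = j then 1 else 0)
                    (fun i' => Fin.insertNth (α := fun _ => MvPolynomial (Fin n × Fin n) ℂ) j 0
                      (fun j' => MvPolynomial.X (i', j')) p.2) p.1)) *
                (Q : Matrix (Fin m) (Fin m) ℂ).map MvPolynomial.C ∧
          (∀ p q : Fin m, a ≤ (p : ℕ) → (q : ℕ) < a → B' p q = 0) ∧
          (∀ p q : Fin m, a + detProjectionComplexity (perPoly (Fin n) ℂ) ≤ (p : ℕ) →
            (q : ℕ) < a + detProjectionComplexity (perPoly (Fin n) ℂ) → B' p q = 0) ∧
          (∀ p q : Fin (detProjectionComplexity (perPoly (Fin n) ℂ)),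
            (∃ v, B' (Fin.castLE h (Fin.natAdd a p)) (Fin.castLE h (Fin.natAdd a q)) = MvPolynomial.X v) ∨
              ∃ c, B' (Fin.castLE h (Fin.natAdd a p)) (Fin.castLE h (Fin.natAdd a q)) = MvPolynomial.C c) ∧
          (B'.submatrix
              (fun p : Fin (detProjectionComplexity (perPoly (Fin n) ℂ)) => Fin.castLE h (Fin.natAdd a p))
              (fun q : Fin (detProjectionComplexity (perPoly (Fin n) ℂ)) => Fin.castLE h (Fin.natAdd a q))).det =
            perPoly (Fin n) ℂ) →
      2 ^ (n + 1) - 1 ≤ m := by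
  sorry

/-! ## The composition (kernel-checked, sorry-free) -/

/-- **The crux from the two stubs.**  Given `ProjOptimalUnique`, `n ≥ 3` and `2^n - 1 ≤ pdc(per_n)`:
take an optimal projection matrix `A` of `per_{n+1}` (`exists_optimal_projMatrix`), of size
`m = pdc(per_{n+1})`.  If `2^(n+1) - 1 ≤ m` we are done; otherwise `m ≤ 2^(n+1) - 2 ≤ 2·pdc(per_n)`, so every
Laplace restriction `A.map ρ_{ij}` — a projection matrix of size `m` computing `per_n` (restriction calculus)
— is a window (stub 1), and core packing (stub 2, fed the level-`n` instance of `ProjOptimalUnique`) gives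
`2^(n+1) - 1 ≤ m` after all. -/
theorem ProjLaplaceDoubling_of :
    Stmt.stub_windowReduction → Stmt.stub_corePacking →
      Summit.ValiantsHypothesis.ValiantsHypothesis.Theses.ProjectionRigidity.ProjLaplaceDoubling := by
  intro hW hP hU n hn hopt
  -- an optimal projection matrix of `per_{n+1}`
  obtain ⟨A, hAproj, hAdet⟩ := exists_optimal_projMatrix (n + 1)
  by_contra hlt
  -- the doubling window
  have hm : detProjectionComplexity (perPoly (Fin (n + 1)) ℂ) ≤
      2 * detProjectionComplexity (perPoly (Fin n) ℂ) := by
    have h2 : 2 ^ (n + 1) = 2 * 2 ^ n := by ring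
    omega
  -- every Laplace restriction is a projection of `per_n` in the window, hence a window (stub 1)
  have hwin : ∀ i j : Fin (n + 1), IsWindow n (detProjectionComplexity (perPoly (Fin (n + 1)) ℂ))
      (A.map (aeval (restrictSubst n i j))) := fun i j =>
    hW n hn hopt _ hm _ (map_restrict_isProj i j hAproj) (det_map_restrict i j hAdet)
  -- core packing (stub 2) with uniqueness at level `n`
  exact hlt (hP n hn (hU n hn) hopt _ A hAproj hAdet hwin)

/-- THE SKELETON: the crux, modulo exactly the two registered stubs (the compiler checks that the `Stmt`
copies and the inlined stub statements agree definitionally). -/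
theorem ProjLaplaceDoubling_proof :
    Summit.ValiantsHypothesis.ValiantsHypothesis.Theses.ProjectionRigidity.ProjLaplaceDoubling :=
  ProjLaplaceDoubling_of stub_windowReduction stub_corePacking

end

end Summit.ValiantsHypothesis.ValiantsHypothesis.Cruxes.ProjLaplaceDoubling.Birth
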